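import Mathlib
import Summits.Ventures.PercRepro2.Defs
import Summits.Ventures.PercRepro2.Graph
import Summits.Ventures.PercRepro2.Harris
import Summits.Ventures.PercRepro2.Events
import Summits.Ventures.PercRepro2.Independence
import Summits.Ventures.PercRepro2.Induced
import Summits.Ventures.PercRepro2.Exploration
import Summits.Ventures.PercRepro2.GateDefs
import Summits.Ventures.PercRepro2.GateAnatomy
import Summits.Ventures.PercRepro2.GateForest
import Summits.Ventures.PercRepro2.GateLSM
import Summits.Ventures.PercRepro2.HullTree
import Summits.Ventures.PercRepro2.GateFeedbackForest
import Summits.Ventures.PercRepro2.GateFeedback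
import Summits.Ventures.PercRepro2.GateFeedbackExit
import Summits.Ventures.PercRepro2.GateContract
import Summits.Ventures.PercRepro2.GateShadow
import Summits.Ventures.PercRepro2.GateSide
import Summits.Ventures.PercRepro2.GateSep

import Summits.Ventures.PercRepro2.GateNear
/-!
# Restriction to the near region: everything beyond the avoided vertex and beyond the exit can be
cut off (blind cell PercRepro2, mine-c g10; proofs/MINEC-FEEDBACK.md §12)

Let `N := (side_w s ∪ side_w t ∪ {w}) ∩ (side_t s ∪ side_t w ∪ {t})` be the NEAR REGION of the
instance `(s,t,u,w)`: the vertices that are not hidden behind `t` and not hidden behind `w`.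
The class-B mass `massB W = 1[t,u,w ∉ W] · P(C(s) = W) · P(t ↔ w in G ∖ W)` only sees the edges
inside `N`: a root cluster of positive mass lies in `side_w s ∩ side_t s ⊆ N` together with all its
neighbours (`clusterEvent_eq_preimage`), and a `t–w` connection in `G ∖ W` never needs an
excursion beyond `t` or beyond `w` (`connDelEvent_eq_preimage`, a closure argument). Hence
  `massB_G (s,t,u,w) = massB_{G[N]} (s,t,u,w)`      (`massB_restrict`)
where `G[N]` is the edge family `within ends N` on its own edge type (marginalisation
`prob_resF_preimage`). So the FKG lattice condition of `G[N]` is that of `G`, and the forest theorems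
of g9 apply to `G[N]`:

**THEOREM** (`gateRow_of_isForest_near`): if the edges inside the near region not at `t` form a
forest (resp. not at `w`), the free one-sided gate holds — the parts of `G` beyond the avoided vertex
and beyond the exit are arbitrary.
-/


namespace Summit.Ventures.PercRepro2

namespace GateRestrict

open scoped Classical


variable {V : Type*} {E : Type*} [Fintype E] [Fintype V]
variable {R : Type*} [Field R] [LinearOrder R] [IsStrictOrderedRing R]

/-! ## The class-B mass is that of the near region -/

section Mass

/- The restricted edge family lives on a SUBTYPE of `E`; in this section the classical
`DecidableEq` must win over `Subtype.instDecidableEq`, so that the instances inside `GateLSM.massB`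
on `G[near]` coincide with those baked into the g9 / GateSep lemmas
(`fun a b => Classical.propDecidable _`); the marginalisation lemma above was stated with the
default instance and is bridged by `GateFeedback.prob_congr_inst`. -/
attribute [local instance 2000] Classical.propDecidable

variable {ends : E → Sym2 V}

omit [LinearOrder R] [IsStrictOrderedRing R] in
/-- **`massB_G = massB_{G[near]}`** for the instance `(s,t,u,w)` (`s, t, w` distinct). -/
theorem massB_restrict (p : E → R) (s t u w : V) (hst : s ≠ t) (hsw : s ≠ w) (htw : t ≠ w)
    (W : Finset V) :
    GateLSM.massB p ends s t u w W =
      GateLSM.massB (GateNear.pR (GateNear.nearEdges ends s t w) p) (GateNear.endsR (GateNear.nearEdges ends s t w) ends) s t u w W := by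
  have key := GateSep.massB_eq_connDel (GateNear.pR (GateNear.nearEdges ends s t w) p)
    (GateNear.endsR (GateNear.nearEdges ends s t w) ends) s t u w W
  rw [GateSep.massB_eq_connDel, key]
  split_ifs with h
  · rfl
  · simp only [not_or] at h
    obtain ⟨ht, hu, hw⟩ := h
    by_cases hside : ∀ x ∈ W, x ∈ GateSide.side ends w s ∧ x ∈ GateSide.side ends t s
    · -- `W ⊆ N` with all its neighbours in `N`
      have hWN : (↑W : Set V) ⊆ GateNear.near ends s t w := fun x hx =>
        GateNear.mem_near_of_sides (hside x (Finset.mem_coe.1 hx)).1 (hside x (Finset.mem_coe.1 hx)).2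
      have hcl : ∀ x ∈ W, ∀ y, (∃ e, ends e = s(x, y)) → y ∈ GateNear.near ends s t w := by
        intro x hx y hxy
        obtain ⟨e, hends⟩ := hxy
        by_cases hyt : y = t
        · rw [hyt]; exact GateNear.t_mem_near htw
        by_cases hyw : y = w
        · rw [hyw]; exact GateNear.w_mem_near htw
        exact GateNear.mem_near_of_sides
          (GateSide.mem_side_of_openAdj hsw (hside x hx).1 (ω := fun _ => true) ⟨e, rfl, hends⟩ hyw)
          (GateSide.mem_side_of_openAdj hst (hside x hx).2 (ω := fun _ => true) ⟨e, rfl, hends⟩ hyt)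
      rw [GateNear.clusterEvent_eq_preimage hWN hcl, GateNear.connDelEvent_eq_preimage hst hsw htw W,
        GateNear.prob_resF_preimage, GateNear.prob_resF_preimage]
      exact congrArg₂ (· * ·) (GateFeedback.prob_congr_inst _ _ _ _)
        (GateFeedback.prob_congr_inst _ _ _ _)
    · -- no configuration has `C(s) = W`, in `G` or in `G[N]`
      obtain ⟨x, hx, hxs⟩ : ∃ x ∈ W, ¬ (x ∈ GateSide.side ends w s ∧ x ∈ GateSide.side ends t s) := by
        by_contra hne
        exact hside fun x hx => by_contra fun hc => hne ⟨x, hx, hc⟩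
      have hG : clusterEvent ends s (↑W : Set V) = ∅ := by
        rw [Set.eq_empty_iff_forall_notMem]
        intro ω hω
        exact hxs ⟨GateSep.subset_side_of_clusterEvent hw hω hx,
          GateSep.subset_side_of_clusterEvent ht hω hx⟩
      have hmono : ∀ z x, GateSide.side (GateNear.endsR (GateNear.nearEdges ends s t w) ends) z x ⊆
          GateSide.side ends z x := by
        intro z x v hv
        refine hv.mono ?_
        intro a b hab
        rw [openGraph_adj] at hab ⊢
        obtain ⟨hne, e, he, hends⟩ := hab
        exact ⟨hne, ⟨e.1.1, e.2⟩, he, hends⟩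
      have hF : clusterEvent (GateNear.endsR (GateNear.nearEdges ends s t w) ends) s (↑W : Set V) = ∅ := by
        rw [Set.eq_empty_iff_forall_notMem]
        intro σ hσ
        exact hxs ⟨hmono w s (GateSep.subset_side_of_clusterEvent hw hσ hx),
          hmono t s (GateSep.subset_side_of_clusterEvent ht hσ hx)⟩
      rw [hG, hF, prob_empty, prob_empty, zero_mul, zero_mul]

omit [IsStrictOrderedRing R] in
/-- The FKG lattice condition of the near region is that of `G`. -/
theorem massBLogSupermod_of_restrict {p : E → R} {s t u w : V} (hst : s ≠ t) (hsw : s ≠ w)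
    (htw : t ≠ w)
    (h : GateLSM.MassBLogSupermod (GateNear.pR (GateNear.nearEdges ends s t w) p)
      (GateNear.endsR (GateNear.nearEdges ends s t w) ends) s t u w) :
    GateLSM.MassBLogSupermod p ends s t u w := by
  intro W₁ W₂
  rw [massB_restrict p s t u w hst hsw htw W₁, massB_restrict p s t u w hst hsw htw W₂,
    massB_restrict p s t u w hst hsw htw (W₁ ∩ W₂), massB_restrict p s t u w hst hsw htw (W₁ ∪ W₂)]
  exact h W₁ W₂

end Mass


/-! ## The forest hypothesis in flat form -/

section Flat

omit [Fintype E] [Fintype V] in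
/-- `IsForest` transfers along an equivalence of edge types that respects the ends. -/
lemma isForest_congr_equiv {E₁ E₂ : Type*} {ends₁ : E₁ → Sym2 V} {ends₂ : E₂ → Sym2 V}
    (φ : E₁ ≃ E₂) (h : ∀ e, ends₂ (φ e) = ends₁ e) : Hull.IsForest ends₁ ↔ Hull.IsForest ends₂ := by
  have hG : openGraph ends₁ (fun _ => true) = openGraph ends₂ (fun _ => true) := by
    ext x y
    rw [openGraph_adj, openGraph_adj]
    refine and_congr_right fun _ => ⟨?_, ?_⟩
    · rintro ⟨e, _, he⟩
      exact ⟨φ e, rfl, by rw [h e, he]⟩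
    · rintro ⟨e, _, he⟩
      exact ⟨φ.symm e, rfl, by rw [← h (φ.symm e), Equiv.apply_symm_apply, he]⟩
  unfold Hull.IsForest
  rw [hG]
  refine and_congr ?_ Iff.rfl
  constructor
  · intro hi e e' hee'
    have : ends₁ (φ.symm e) = ends₁ (φ.symm e') := by
      rw [← h (φ.symm e), ← h (φ.symm e'), Equiv.apply_symm_apply, Equiv.apply_symm_apply, hee']
    exact φ.symm.injective (hi this)
  · intro hi e e' hee'
    have : ends₂ (φ e) = ends₂ (φ e') := by rw [h e, h e', hee']
    exact φ.injective (hi this)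

omit [Fintype E] [Fintype V] in
/-- The forest part of `G[near]` at `z` is the family of the edges inside the near region not at
`z`, in flat form. -/
lemma isForest_endsF_endsR_iff (ends : E → Sym2 V) (s t w z : V) :
    Hull.IsForest (GateFeedback.endsF (GateNear.endsR (GateNear.nearEdges ends s t w) ends) z) ↔
      Hull.IsForest (fun e : {e // e ∈ GateNear.nearEdges ends s t w ∧ z ∉ ends e} => ends e.1) :=
  isForest_congr_equiv (Equiv.subtypeSubtypeEquivSubtypeInter (· ∈ GateNear.nearEdges ends s t w)
    fun e => z ∉ ends e) fun _ => rfl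

omit [Fintype E] [Fintype V] in
/-- A sub-family of a forest is a forest: if `ι : E₁ → E₂` is injective and respects the ends,
`IsForest ends₂ → IsForest ends₁`. -/
lemma isForest_of_injective {E₁ E₂ : Type*} {ends₁ : E₁ → Sym2 V} {ends₂ : E₂ → Sym2 V}
    (ι : E₁ → E₂) (hι : Function.Injective ι) (h : ∀ e, ends₂ (ι e) = ends₁ e)
    (hF : Hull.IsForest ends₂) : Hull.IsForest ends₁ := by
  refine ⟨fun e e' hee' => hι (hF.1 (by rw [h e, h e', hee'])), ?_⟩
  have hle : openGraph ends₁ (fun _ => true) ≤ openGraph ends₂ (fun _ => true) := by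
    intro x y hxy
    rw [openGraph_adj] at hxy ⊢
    obtain ⟨hne, e, _, he⟩ := hxy
    exact ⟨hne, ι e, rfl, by rw [h e, he]⟩
  exact SimpleGraph.IsAcyclic.anti hle hF.2

omit [Fintype E] [Fintype V] in
/-- `G − t` a forest ⟹ the edges inside the near region not at `t` form a forest. -/
lemma isForest_near_of_isForest_del (ends : E → Sym2 V) (s t w : V)
    (hF : Hull.IsForest (GateFeedback.endsF ends t)) :
    Hull.IsForest (fun e : {e // e ∈ GateNear.nearEdges ends s t w ∧ t ∉ ends e} => ends e.1) :=
  isForest_of_injective (fun e => ⟨e.1, e.2.2⟩)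
    (fun e e' h => Subtype.ext (by simpa using congrArg Subtype.val h)) (fun _ => rfl) hF

omit [Fintype E] in
/-- The components of `s` and `w` in `G − t` trees (Theorem 4's hypothesis) ⟹ the edges inside the
near region not at `t` form a forest. -/
lemma isForest_near_of_isForest_shadow (ends : E → Sym2 V) (s t w : V)
    (hF : Hull.IsForest (GateContract.endsDel ends (GateShadow.shadow ends {t} s w))) :
    Hull.IsForest (fun e : {e // e ∈ GateNear.nearEdges ends s t w ∧ t ∉ ends e} => ends e.1) := by
  -- an edge inside the near region not at `t` avoids the shadow of `{t}`: both of its ends are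
  -- reachable from `s` or from `w` in `G − t`
  have hmem : ∀ e : {e // e ∈ GateNear.nearEdges ends s t w ∧ t ∉ ends e},
      ∀ x ∈ GateShadow.shadow ends {t} s w, x ∉ ends e.1 := by
    intro e x hx hxe
    obtain ⟨a, ha, b, hb, hab⟩ := GateNear.mem_nearEdges.1 e.2.1
    have hnot : ∀ v, v ∈ GateNear.near ends s t w → v ∈ ends e.1 →
        v ∉ GateShadow.shadow ends {t} s w := by
      intro v hv hve hvsh
      rw [GateShadow.mem_shadow] at hvsh
      rcases hv.2 with (h1 | h1) | h1
      · exact hvsh.1 h1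
      · exact hvsh.2 h1
      · have hvt : v = t := Set.mem_singleton_iff.1 h1
        exact e.2.2 (hvt ▸ hve)
    have hxmem : x ∈ ends e.1 := hxe
    rw [hab, Sym2.mem_iff] at hxmem
    rcases hxmem with rfl | rfl
    · exact hnot x ha hxe hx
    · exact hnot x hb hxe hx
  exact isForest_of_injective (fun e => ⟨e.1, hmem e⟩)
    (fun e e' h => Subtype.ext (by simpa using congrArg Subtype.val h)) (fun _ => rfl) hF

end Flat

/-! ## The theorems -/

section Theorem

attribute [local instance 2000] Classical.propDecidable

variable {ends : E → Sym2 V}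

/-- **THEOREM (the near region decides).** If the edges inside the near region of `(s,t,w)` that
are not at `t` form a forest, the free one-sided gate holds; everything beyond `t` and beyond `w`
is arbitrary. -/
theorem gateRow_of_isForest_near {p : E → R} (hp : IsProbVec p) (s t a b u w : V) (hst : s ≠ t)
    (hsw : s ≠ w) (htw : t ≠ w)
    (hF : Hull.IsForest (GateFeedback.endsF (GateNear.endsR (GateNear.nearEdges ends s t w) ends) t)) :
    Gate.GateRow p ends s {t} a b {u} {w} := by
  have h1 := GateFeedback.massBLogSupermod_of_isForest_del (s := s) (u := u)
    (GateNear.IsProbVec.pR (GateNear.nearEdges ends s t w) hp) hF htw.symm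
  have h2 := massBLogSupermod_of_restrict hst hsw htw h1
  exact GateSep.gateRow_of_massBLogSupermod hp s t a b u w h2

/-- **THEOREM (the near region decides, exit version).** If the edges inside the near region not at
`w` form a forest, the free one-sided gate holds. -/
theorem gateRow_of_isForest_near_exit {p : E → R} (hp : IsProbVec p) (s t a b u w : V)
    (hst : s ≠ t) (hsw : s ≠ w) (htw : t ≠ w)
    (hF : Hull.IsForest (GateFeedback.endsF (GateNear.endsR (GateNear.nearEdges ends s t w) ends) w)) :
    Gate.GateRow p ends s {t} a b {u} {w} := by
  have h1 := GateFeedback.massBLogSupermod_of_isForest_del_exit (s := s) (u := u)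
    (GateNear.IsProbVec.pR (GateNear.nearEdges ends s t w) hp) hF htw.symm
  have h2 := massBLogSupermod_of_restrict hst hsw htw h1
  exact GateSep.gateRow_of_massBLogSupermod hp s t a b u w h2

/-- `gateRow_of_isForest_near` with the forest hypothesis in flat form: the edges inside the GateNear.near
region not at `t` form a forest. -/
theorem gateRow_of_isForest_near' {p : E → R} (hp : IsProbVec p) (s t a b u w : V) (hst : s ≠ t)
    (hsw : s ≠ w) (htw : t ≠ w)
    (hF : Hull.IsForest (fun e : {e // e ∈ GateNear.nearEdges ends s t w ∧ t ∉ ends e} => ends e.1)) :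
    Gate.GateRow p ends s {t} a b {u} {w} :=
  gateRow_of_isForest_near hp s t a b u w hst hsw htw ((isForest_endsF_endsR_iff ends s t w t).2 hF)

/-- `gateRow_of_isForest_near_exit` with the forest hypothesis in flat form. -/
theorem gateRow_of_isForest_near_exit' {p : E → R} (hp : IsProbVec p) (s t a b u w : V)
    (hst : s ≠ t) (hsw : s ≠ w) (htw : t ≠ w)
    (hF : Hull.IsForest (fun e : {e // e ∈ GateNear.nearEdges ends s t w ∧ w ∉ ends e} => ends e.1)) :
    Gate.GateRow p ends s {t} a b {u} {w} :=
  gateRow_of_isForest_near_exit hp s t a b u w hst hsw htw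
    ((isForest_endsF_endsR_iff ends s t w w).2 hF)

/-- **Theorem 1 as a corollary of the near-region theorem**: `G − t` a forest. -/
theorem gateRow_of_isForest_del_via_near {p : E → R} (hp : IsProbVec p) (s t a b u w : V)
    (hst : s ≠ t) (hsw : s ≠ w) (htw : t ≠ w) (hF : Hull.IsForest (GateFeedback.endsF ends t)) :
    Gate.GateRow p ends s {t} a b {u} {w} :=
  gateRow_of_isForest_near' hp s t a b u w hst hsw htw (isForest_near_of_isForest_del ends s t w hF)

/-- **Theorem 4 as a corollary of the near-region theorem**: the components of `s` and `w` in
`G − t` are trees. -/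
theorem gateRow_of_isForest_shadow_via_near {p : E → R} (hp : IsProbVec p) (s t a b u w : V)
    (hst : s ≠ t) (hsw : s ≠ w) (htw : t ≠ w)
    (hF : Hull.IsForest (GateContract.endsDel ends (GateShadow.shadow ends {t} s w))) :
    Gate.GateRow p ends s {t} a b {u} {w} :=
  gateRow_of_isForest_near' hp s t a b u w hst hsw htw
    (isForest_near_of_isForest_shadow ends s t w hF)

end Theorem

end GateRestrict

end Summit.Ventures.PercRepro2
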